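import Mathlib
import HarnessLib
import Summits.ValiantsHypothesis.ValiantsHypothesis.Theorems.LacunarySymmetroidMatrixDescartesProductPlusOneSharpKCoefficients

/-!
# ValiantsHypothesis / LacunarySymmetroid — crux `MatrixDescartes` (stmt-ValiantsHypothesis-18050, V1),
# LINE (A) «product_plus_one»: the SHARP SECTOR for GENERAL `K` — part 2, REAL-VARIABLE ANALYSIS

Elementary real analysis of a real polynomial `f` near its SIMPLE zeros, used by the level-budget proof of the «log-scale Laguerre
inequality for Descartes-sharp fewnomials» (memo §13): the derivative at the right end of a zero-free interval has the sign opposite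
to `f` on it and at the left end the same sign (`eval_mul_derivative_neg_of_right_end`, `…_pos_of_left_end`, mean value theorem); hence
between two consecutive simple zeros EVERY Euler transform `X·f′ − μ·f` vanishes (`exists_euler_root_in_gap`); the logarithmic
derivative `x f′/f` is unbounded above at the left end of a zero-free interval that starts at a zero and unbounded below at a right end
that is a zero (`exists_phi_gt_near_left_zero`, `exists_phi_lt_near_right_zero`); a sparse sum has the sign of its lowest term near
`0⁺` (`sparse_sign_near_zero`) and of its top term near `+∞` (`sparse_sign_near_top`); and a Descartes-sharp fewnomial has only simple
positive zeros (`derivative_ne_zero_of_sharp`).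

HONEST FRAMING: analysis lemmas; NOT `stub_classRowK3`, not `stub_polyLaw`, not `ProductPlusOneMDR`, not `MatrixDescartes`, not
Conjecture B; `VP ≠ VNP` is NOT proved.  No definitions, no named facts; Mathlib + part 1.
-/

-- `Summit.ValiantsHypothesis.ValiantsHypothesis.…` is the tree's mandated single-conjunct layout (Sub = Summit).
set_option linter.dupNamespace false

namespace Summit.ValiantsHypothesis.ValiantsHypothesis.Theorems.LacunarySymmetroidMatrixDescartes

namespace ProductPlusOne

open Polynomial Finset
open scoped BigOperators

/-! ### The sign of `f′` at the ends of a zero-free interval -/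

/-- A continuous sign change of a polynomial on `[a, b]` produces a zero in `(a, b)`. [folklore] -/
theorem exists_root_of_mul_neg (f : ℝ[X]) {a b : ℝ} (hab : a < b) (hneg : f.eval a * f.eval b < 0) :
    ∃ t ∈ Set.Ioo a b, f.eval t = 0 := by
  have hcont : ContinuousOn (fun t => f.eval t) (Set.Icc a b) := f.continuous.continuousOn
  rcases lt_or_gt_of_ne (show f.eval a ≠ 0 from fun h => by rw [h, zero_mul] at hneg; exact lt_irrefl 0 hneg) with ha | ha
  · have hb : 0 < f.eval b := by
      by_contra h
      push Not at h
      nlinarith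
    obtain ⟨t, ht, ht0⟩ := intermediate_value_Ioo hab.le hcont ⟨ha, hb⟩
    exact ⟨t, ht, ht0⟩
  · have hb : f.eval b < 0 := by
      by_contra h
      push Not at h
      nlinarith
    obtain ⟨t, ht, ht0⟩ := intermediate_value_Ioo' hab.le hcont ⟨hb, ha⟩
    exact ⟨t, ht, ht0⟩

/-- No zero on `(u, v)` and `x₀, x ∈ (u,v)` ⇒ `f(x₀)·f(x) > 0`. [folklore] -/
theorem eval_mul_eval_pos_of_free (f : ℝ[X]) {u v x₀ x : ℝ} (hfree : ∀ t ∈ Set.Ioo u v, f.eval t ≠ 0)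
    (hx₀ : x₀ ∈ Set.Ioo u v) (hx : x ∈ Set.Ioo u v) : 0 < f.eval x₀ * f.eval x := by
  by_contra hcon
  push Not at hcon
  have hlt : f.eval x₀ * f.eval x < 0 := lt_of_le_of_ne hcon (mul_ne_zero (hfree x₀ hx₀) (hfree x hx))
  rcases lt_trichotomy x₀ x with h | h | h
  · obtain ⟨t, ht, ht0⟩ := exists_root_of_mul_neg f h hlt
    exact hfree t ⟨hx₀.1.trans ht.1, ht.2.trans hx.2⟩ ht0
  · rw [h] at hlt
    nlinarith
  · obtain ⟨t, ht, ht0⟩ := exists_root_of_mul_neg f h (by rwa [mul_comm] at hlt)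
    exact hfree t ⟨hx.1.trans ht.1, ht.2.trans hx₀.2⟩ ht0

/-- **Right end**: `f ≠ 0` on `(u, z)`, `f(z) = 0`, `f′(z) ≠ 0`, `x₀ ∈ (u, z)` ⇒ `f(x₀)·f′(z) < 0`. [folklore] -/
theorem eval_mul_derivative_neg_of_right_end (f : ℝ[X]) {u z x₀ : ℝ} (hfree : ∀ t ∈ Set.Ioo u z, f.eval t ≠ 0)
    (hz : f.eval z = 0) (hdz : (derivative f).eval z ≠ 0) (hx₀ : x₀ ∈ Set.Ioo u z) :
    f.eval x₀ * (derivative f).eval z < 0 := by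
  by_contra hcon
  push Not at hcon
  have hpos : 0 < f.eval x₀ * (derivative f).eval z := lt_of_le_of_ne hcon (mul_ne_zero (hfree x₀ hx₀) hdz).symm
  -- continuity of f' at z: f'(t) f(x₀) > 0 for t near z
  have hcont : ContinuousAt (fun t : ℝ => f.eval x₀ * (derivative f).eval t) z :=
    (continuous_const.mul (derivative f).continuous).continuousAt
  have hev : ∀ᶠ t in nhds z, 0 < f.eval x₀ * (derivative f).eval t := hcont.eventually (isOpen_Ioi.mem_nhds hpos)
  obtain ⟨δ, hδ, hball⟩ := Metric.eventually_nhds_iff.mp hev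
  -- pick x ∈ (x₀, z) within δ of z
  set x := max x₀ (z - δ / 2) + (z - max x₀ (z - δ / 2)) / 2 with hx
  have hxlt : x < z := by
    have : max x₀ (z - δ / 2) < z := max_lt hx₀.2 (by linarith)
    rw [hx]; linarith
  have hxgt : x₀ < x := by
    have : x₀ ≤ max x₀ (z - δ / 2) := le_max_left _ _
    have h2 : max x₀ (z - δ / 2) < z := max_lt hx₀.2 (by linarith)
    rw [hx]; linarith
  have hxδ : z - δ / 2 < x := by
    have : z - δ / 2 ≤ max x₀ (z - δ / 2) := le_max_right _ _
    have h2 : max x₀ (z - δ / 2) < z := max_lt hx₀.2 (by linarith)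
    rw [hx]; linarith
  -- MVT on [x, z]
  obtain ⟨ξ, hξ, hξeq⟩ := exists_deriv_eq_slope (fun t : ℝ => f.eval t) hxlt f.continuous.continuousOn
    (f.differentiable.differentiableOn)
  rw [Polynomial.deriv, hz, zero_sub] at hξeq
  have hξz : dist ξ z < δ := by
    rw [Real.dist_eq, abs_lt]
    constructor <;> linarith [hξ.1, hξ.2]
  have h1 := hball hξz
  rw [hξeq] at h1
  -- f(x) has the sign of f(x₀)
  have h2 := eval_mul_eval_pos_of_free f hfree hx₀ ⟨hx₀.1.trans hxgt, hxlt⟩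
  have hzx : 0 < z - x := by linarith
  have h3 : f.eval x₀ * (-eval x f / (z - x)) = -(f.eval x₀ * f.eval x) / (z - x) := by ring
  rw [h3] at h1
  have h4 : -(f.eval x₀ * f.eval x) / (z - x) < 0 := div_neg_of_neg_of_pos (by linarith) hzx
  linarith

/-- **Left end**: `f ≠ 0` on `(z, v)`, `f(z) = 0`, `f′(z) ≠ 0`, `x₀ ∈ (z, v)` ⇒ `f(x₀)·f′(z) > 0`. [folklore] -/
theorem eval_mul_derivative_pos_of_left_end (f : ℝ[X]) {z v x₀ : ℝ} (hfree : ∀ t ∈ Set.Ioo z v, f.eval t ≠ 0)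
    (hz : f.eval z = 0) (hdz : (derivative f).eval z ≠ 0) (hx₀ : x₀ ∈ Set.Ioo z v) :
    0 < f.eval x₀ * (derivative f).eval z := by
  -- reflect: g(t) = f(−t) … simpler to redo the MVT argument on [z, x]
  by_contra hcon
  push Not at hcon
  have hneg : f.eval x₀ * (derivative f).eval z < 0 := lt_of_le_of_ne hcon (mul_ne_zero (hfree x₀ hx₀) hdz)
  have hcont : ContinuousAt (fun t : ℝ => f.eval x₀ * (derivative f).eval t) z :=
    (continuous_const.mul (derivative f).continuous).continuousAt
  have hev : ∀ᶠ t in nhds z, f.eval x₀ * (derivative f).eval t < 0 := hcont.eventually (isOpen_Iio.mem_nhds hneg)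
  obtain ⟨δ, hδ, hball⟩ := Metric.eventually_nhds_iff.mp hev
  set x := z + (min x₀ (z + δ / 2) - z) / 2 with hx
  have hmin : z < min x₀ (z + δ / 2) := lt_min hx₀.1 (by linarith)
  have hxgt : z < x := by rw [hx]; linarith
  have hxlt : x < x₀ := by
    have : min x₀ (z + δ / 2) ≤ x₀ := min_le_left _ _
    rw [hx]; linarith
  have hxδ : x < z + δ / 2 := by
    have : min x₀ (z + δ / 2) ≤ z + δ / 2 := min_le_right _ _
    rw [hx]; linarith
  obtain ⟨ξ, hξ, hξeq⟩ := exists_deriv_eq_slope (fun t : ℝ => f.eval t) hxgt f.continuous.continuousOn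
    (f.differentiable.differentiableOn)
  rw [Polynomial.deriv, hz, sub_zero] at hξeq
  have hξz : dist ξ z < δ := by
    rw [Real.dist_eq, abs_lt]
    constructor <;> linarith [hξ.1, hξ.2]
  have h1 := hball hξz
  rw [hξeq] at h1
  have h2 := eval_mul_eval_pos_of_free f hfree hx₀ ⟨hxgt, hxlt.trans hx₀.2⟩
  have hzx : 0 < x - z := by linarith
  have h3 : f.eval x₀ * (eval x f / (x - z)) = (f.eval x₀ * f.eval x) / (x - z) := by ring
  rw [h3] at h1
  have h4 : 0 < (f.eval x₀ * f.eval x) / (x - z) := div_pos h2 hzx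
  linarith

/-- **Forced Euler zero in a gap**: between two consecutive simple zeros `z < z′` of `f`, every `X·f′ − μ·f` vanishes somewhere
(`0 < z`). [folklore] -/
theorem exists_euler_root_in_gap (f : ℝ[X]) {z z' : ℝ} (hz0 : 0 < z) (hzz : z < z')
    (hfree : ∀ t ∈ Set.Ioo z z', f.eval t ≠ 0) (hz : f.eval z = 0) (hz' : f.eval z' = 0)
    (hdz : (derivative f).eval z ≠ 0) (hdz' : (derivative f).eval z' ≠ 0) (μ : ℝ) :
    ∃ t ∈ Set.Ioo z z', (X * derivative f - C μ * f).eval t = 0 := by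
  have hx₀ : (z + z') / 2 ∈ Set.Ioo z z' := ⟨by linarith, by linarith⟩
  have h1 := eval_mul_derivative_pos_of_left_end f hfree hz hdz hx₀
  have h2 := eval_mul_derivative_neg_of_right_end f hfree hz' hdz' hx₀
  have hg : ∀ t, (X * derivative f - C μ * f).eval t = t * (derivative f).eval t - μ * f.eval t := by
    intro t; simp [eval_sub, eval_mul, eval_X, eval_C]
  have hgz : (X * derivative f - C μ * f).eval z = z * (derivative f).eval z := by rw [hg, hz, mul_zero, sub_zero]
  have hgz' : (X * derivative f - C μ * f).eval z' = z' * (derivative f).eval z' := by rw [hg, hz', mul_zero, sub_zero]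
  -- signs of g at the two ends are opposite
  have hprod : (X * derivative f - C μ * f).eval z * (X * derivative f - C μ * f).eval z' < 0 := by
    rw [hgz, hgz']
    have hzz' : 0 < z * z' := mul_pos hz0 (hz0.trans hzz)
    have : (derivative f).eval z * (derivative f).eval z' < 0 := by
      have hsq : 0 < (f.eval ((z + z') / 2)) ^ 2 := by
        have := hfree _ hx₀; positivity
      nlinarith
    nlinarith
  exact exists_root_of_mul_neg _ hzz hprod

/-! ### Blow-up of the logarithmic derivative at zeros -/

/-- **`x f′/f → +∞` at the left end**: `f ≠ 0` on `(z, v)`, `f(z) = 0`, `f′(z) ≠ 0`, `0 < z`; for every bound `V` and every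
`w ∈ (z, v)` there is `w₀ ∈ (z, w)` with `w₀ f′(w₀)/f(w₀) > V`. [folklore] -/
theorem exists_phi_gt_near_left_zero (f : ℝ[X]) {z v w : ℝ} (hz0 : 0 < z) (hfree : ∀ t ∈ Set.Ioo z v, f.eval t ≠ 0)
    (hz : f.eval z = 0) (hdz : (derivative f).eval z ≠ 0) (hw : w ∈ Set.Ioo z v) (V : ℝ) :
    ∃ w₀ ∈ Set.Ioo z w, V < w₀ * (derivative f).eval w₀ / f.eval w₀ := by
  -- G(t) := f(w)·(t f′(t) − V f(t)) is positive at z, hence near z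
  have hG : 0 < f.eval w * (z * (derivative f).eval z - V * f.eval z) := by
    have h := eval_mul_derivative_pos_of_left_end f hfree hz hdz hw
    have e : f.eval w * (z * (derivative f).eval z - V * f.eval z) = z * (f.eval w * (derivative f).eval z) := by
      rw [hz]; ring
    rw [e]
    exact mul_pos hz0 h
  have hcont : ContinuousAt (fun t : ℝ => f.eval w * (t * (derivative f).eval t - V * f.eval t)) z := by
    have h1 : Continuous fun t : ℝ => f.eval w * (t * (derivative f).eval t - V * f.eval t) :=
      continuous_const.mul ((continuous_id.mul (derivative f).continuous).sub (continuous_const.mul f.continuous))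
    exact h1.continuousAt
  have hev : ∀ᶠ t in nhds z, 0 < f.eval w * (t * (derivative f).eval t - V * f.eval t) :=
    hcont.eventually (isOpen_Ioi.mem_nhds hG)
  obtain ⟨δ, hδ, hball⟩ := Metric.eventually_nhds_iff.mp hev
  set w₀ := z + (min w (z + δ / 2) - z) / 2 with hw₀
  have hmin : z < min w (z + δ / 2) := lt_min hw.1 (by linarith)
  have h0gt : z < w₀ := by rw [hw₀]; linarith
  have h0lt : w₀ < w := by have := min_le_left w (z + δ / 2); rw [hw₀]; linarith
  have h0δ : w₀ < z + δ / 2 := by have := min_le_right w (z + δ / 2); rw [hw₀]; linarith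
  refine ⟨w₀, ⟨h0gt, h0lt⟩, ?_⟩
  have h1 := hball (show dist w₀ z < δ by rw [Real.dist_eq, abs_lt]; constructor <;> linarith)
  -- f(w) f(w₀) > 0
  have h2 := eval_mul_eval_pos_of_free f hfree hw ⟨h0gt, h0lt.trans hw.2⟩
  have hf0 : f.eval w₀ ≠ 0 := hfree w₀ ⟨h0gt, h0lt.trans hw.2⟩
  have hfw : f.eval w ≠ 0 := hfree w hw
  -- V < w₀ f'(w₀)/f(w₀) ⟺ 0 < (w₀ f'(w₀) − V f(w₀))/f(w₀), and the sign of f(w₀) is that of f(w)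
  have key : 0 < (w₀ * (derivative f).eval w₀ - V * f.eval w₀) / f.eval w₀ := by
    have e : (w₀ * (derivative f).eval w₀ - V * f.eval w₀) / f.eval w₀
        = (f.eval w * (w₀ * (derivative f).eval w₀ - V * f.eval w₀)) * (f.eval w * f.eval w₀) / (f.eval w * f.eval w₀) ^ 2 := by
      field_simp
    rw [e]
    positivity
  have e2 : (w₀ * (derivative f).eval w₀ - V * f.eval w₀) / f.eval w₀ = w₀ * (derivative f).eval w₀ / f.eval w₀ - V := by
    rw [sub_div, mul_div_cancel_right₀ V hf0]
  linarith [e2 ▸ key]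

/-- **`x f′/f → −∞` at the right end**: `f ≠ 0` on `(u, z)`, `f(z) = 0`, `f′(z) ≠ 0`, `0 ≤ u`; for every bound `V` and every
`w ∈ (u, z)` there is `w₃ ∈ (w, z)` with `w₃ f′(w₃)/f(w₃) < V`. [folklore] -/
theorem exists_phi_lt_near_right_zero (f : ℝ[X]) {u z w : ℝ} (hu : 0 ≤ u) (hfree : ∀ t ∈ Set.Ioo u z, f.eval t ≠ 0)
    (hz : f.eval z = 0) (hdz : (derivative f).eval z ≠ 0) (hw : w ∈ Set.Ioo u z) (V : ℝ) :
    ∃ w₃ ∈ Set.Ioo w z, w₃ * (derivative f).eval w₃ / f.eval w₃ < V := by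
  have hz0 : 0 < z := hu.trans_lt (hw.1.trans hw.2)
  have hG : f.eval w * (z * (derivative f).eval z - V * f.eval z) < 0 := by
    have h := eval_mul_derivative_neg_of_right_end f hfree hz hdz hw
    have e : f.eval w * (z * (derivative f).eval z - V * f.eval z) = z * (f.eval w * (derivative f).eval z) := by
      rw [hz]; ring
    rw [e]
    exact mul_neg_of_pos_of_neg hz0 h
  have hcont : ContinuousAt (fun t : ℝ => f.eval w * (t * (derivative f).eval t - V * f.eval t)) z := by
    have h1 : Continuous fun t : ℝ => f.eval w * (t * (derivative f).eval t - V * f.eval t) :=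
      continuous_const.mul ((continuous_id.mul (derivative f).continuous).sub (continuous_const.mul f.continuous))
    exact h1.continuousAt
  have hev : ∀ᶠ t in nhds z, f.eval w * (t * (derivative f).eval t - V * f.eval t) < 0 :=
    hcont.eventually (isOpen_Iio.mem_nhds hG)
  obtain ⟨δ, hδ, hball⟩ := Metric.eventually_nhds_iff.mp hev
  set w₃ := max w (z - δ / 2) + (z - max w (z - δ / 2)) / 2 with hw₃
  have hmax : max w (z - δ / 2) < z := max_lt hw.2 (by linarith)
  have h3lt : w₃ < z := by rw [hw₃]; linarith
  have h3gt : w < w₃ := by have := le_max_left w (z - δ / 2); rw [hw₃]; linarith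
  have h3δ : z - δ / 2 < w₃ := by have := le_max_right w (z - δ / 2); rw [hw₃]; linarith
  refine ⟨w₃, ⟨h3gt, h3lt⟩, ?_⟩
  have h1 := hball (show dist w₃ z < δ by rw [Real.dist_eq, abs_lt]; constructor <;> linarith)
  have h2 := eval_mul_eval_pos_of_free f hfree hw ⟨hw.1.trans h3gt, h3lt⟩
  have hf0 : f.eval w₃ ≠ 0 := hfree w₃ ⟨hw.1.trans h3gt, h3lt⟩
  have hfw : f.eval w ≠ 0 := hfree w hw
  have key : (w₃ * (derivative f).eval w₃ - V * f.eval w₃) / f.eval w₃ < 0 := by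
    have e : (w₃ * (derivative f).eval w₃ - V * f.eval w₃) / f.eval w₃
        = (f.eval w * (w₃ * (derivative f).eval w₃ - V * f.eval w₃)) * (f.eval w * f.eval w₃) / (f.eval w * f.eval w₃) ^ 2 := by
      field_simp
    rw [e]
    exact div_neg_of_neg_of_pos (mul_neg_of_neg_of_pos h1 h2) (by positivity)
  have e2 : (w₃ * (derivative f).eval w₃ - V * f.eval w₃) / f.eval w₃ = w₃ * (derivative f).eval w₃ / f.eval w₃ - V := by
    rw [sub_div, mul_div_cancel_right₀ V hf0]
  linarith [e2 ▸ key]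

/-! ### Sparse sums near `0⁺` and near `+∞` -/

/-- A finite sum `Σ_{i<K} e_i y^{n_i}` with all `n_i ≥ 1` is small near `y = 0`. [folklore] -/
theorem sparse_tail_small (K : ℕ) (n : ℕ → ℕ) (hn : ∀ i, i < K → 1 ≤ n i) (e : ℕ → ℝ) {ε : ℝ} (hε : 0 < ε) :
    ∃ δ : ℝ, 0 < δ ∧ ∀ y : ℝ, |y| < δ → |∑ i ∈ Finset.range K, e i * y ^ (n i)| < ε := by
  have hcont : Continuous fun y : ℝ => ∑ i ∈ Finset.range K, e i * y ^ (n i) :=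
    continuous_finsetSum _ (fun i _ => continuous_const.mul (continuous_pow _))
  have h0 : ∑ i ∈ Finset.range K, e i * (0 : ℝ) ^ (n i) = 0 := by
    refine Finset.sum_eq_zero (fun i hi => ?_)
    rw [zero_pow (by have := hn i (Finset.mem_range.mp hi); omega), mul_zero]
  have hc0 := hcont.continuousAt (x := 0)
  rw [Metric.continuousAt_iff] at hc0
  obtain ⟨δ, hδ, h⟩ := hc0 ε hε
  refine ⟨δ, hδ, fun y hy => ?_⟩
  have := h (show dist y 0 < δ by rwa [Real.dist_eq, sub_zero])
  rwa [Real.dist_eq, h0, sub_zero] at this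

/-- **Sign near `0⁺`**: a sparse sum `Σ_{i ≤ K} c_i x^{d_i}` (`d` strictly increasing, `c_0 ≠ 0`) has the sign of `c_0` on some
`(0, δ)`. [folklore] -/
theorem sparse_sign_near_zero (K : ℕ) (d : ℕ → ℕ) (hd : StrictMono d) (c : ℕ → ℝ) (hc0 : c 0 ≠ 0) :
    ∃ δ : ℝ, 0 < δ ∧ ∀ x : ℝ, 0 < x → x < δ → 0 < c 0 * ∑ i ∈ Finset.range (K + 1), c i * x ^ (d i) := by
  -- tail R(x) = Σ_{i<K} c_{i+1} x^{d_{i+1} − d_0}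
  obtain ⟨δ, hδ, hR⟩ := sparse_tail_small K (fun i => d (i + 1) - d 0)
    (fun i _ => Nat.one_le_iff_ne_zero.mpr (Nat.sub_ne_zero_of_lt (hd (Nat.succ_pos i)))) (fun i => c (i + 1))
    (show 0 < |c 0| / 2 by positivity)
  refine ⟨δ, hδ, fun x hx hxδ => ?_⟩
  have hterm : ∀ i ∈ Finset.range K, c (i + 1) * x ^ (d (i + 1)) = x ^ (d 0) * (c (i + 1) * x ^ (d (i + 1) - d 0)) := by
    intro i _
    rw [mul_left_comm, ← pow_add, Nat.add_sub_cancel' (hd (Nat.succ_pos i)).le]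
  have hsplit : ∑ i ∈ Finset.range (K + 1), c i * x ^ (d i)
      = x ^ (d 0) * (c 0 + ∑ i ∈ Finset.range K, c (i + 1) * x ^ (d (i + 1) - d 0)) := by
    rw [Finset.sum_range_succ', Finset.sum_congr rfl hterm, ← Finset.mul_sum]
    ring
  rw [hsplit]
  have h1 := hR x (by rwa [abs_of_pos hx])
  have hxd : 0 < x ^ (d 0) := pow_pos hx _
  have h2 : 0 < c 0 * (c 0 + ∑ i ∈ Finset.range K, c (i + 1) * x ^ (d (i + 1) - d 0)) := by
    have habs : |c 0| ^ 2 = c 0 ^ 2 := sq_abs _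
    have hc2 : 0 < |c 0| := abs_pos.mpr hc0
    nlinarith [abs_le.mp h1.le, neg_abs_le (c 0), le_abs_self (c 0),
      abs_nonneg (∑ i ∈ Finset.range K, c (i + 1) * x ^ (d (i + 1) - d 0)), sq_nonneg (c 0),
      mul_pos hc2 hc2, abs_mul_abs_self (c 0)]
  have : c 0 * (x ^ d 0 * (c 0 + ∑ i ∈ Finset.range K, c (i + 1) * x ^ (d (i + 1) - d 0)))
      = x ^ d 0 * (c 0 * (c 0 + ∑ i ∈ Finset.range K, c (i + 1) * x ^ (d (i + 1) - d 0))) := by ring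
  rw [this]
  exact mul_pos hxd h2

/-- **Sign near `+∞`**: a sparse sum `Σ_{i ≤ K} c_i x^{d_i}` (`d` strictly increasing, `c_K ≠ 0`) has the sign of `c_K` at some point
beyond any bound `B`. [folklore] -/
theorem sparse_sign_near_top (K : ℕ) (d : ℕ → ℕ) (hd : StrictMono d) (c : ℕ → ℝ) (hcK : c K ≠ 0) (B : ℝ) :
    ∃ x : ℝ, B < x ∧ 0 < c K * ∑ i ∈ Finset.range (K + 1), c i * x ^ (d i) := by
  -- y = 1/x: Σ c_i x^{d_i} = x^{d_K} (c_K + Σ_{i<K} c_i y^{d_K − d_i})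
  obtain ⟨δ, hδ, hR⟩ := sparse_tail_small K (fun i => d K - d i)
    (fun i hi => Nat.one_le_iff_ne_zero.mpr (Nat.sub_ne_zero_of_lt (hd hi))) c (show 0 < |c K| / 2 by positivity)
  set x := max B 0 + 1 / δ + 1 with hx
  have hδ1 : 0 < 1 / δ := by positivity
  have hxB : B < x := by
    have := le_max_left B 0
    rw [hx]
    linarith
  have hx0 : 0 < x := by
    have := le_max_right B 0
    rw [hx]
    linarith
  have hxδ : x⁻¹ < δ := by
    rw [inv_lt_comm₀ hx0 hδ, ← one_div]
    have := le_max_right B 0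
    rw [hx]
    linarith
  refine ⟨x, hxB, ?_⟩
  have hterm : ∀ i ∈ Finset.range K, c i * x ^ (d i) = x ^ (d K) * (c i * x⁻¹ ^ (d K - d i)) := by
    intro i hi
    have hle : d i ≤ d K := (hd (Finset.mem_range.mp hi)).le
    have hxK : x ^ d K = x ^ d i * x ^ (d K - d i) := by rw [← pow_add, Nat.add_sub_cancel' hle]
    rw [hxK, inv_pow]
    field_simp
  have hsplit : ∑ i ∈ Finset.range (K + 1), c i * x ^ (d i)
      = x ^ (d K) * (c K + ∑ i ∈ Finset.range K, c i * x⁻¹ ^ (d K - d i)) := by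
    rw [Finset.sum_range_succ, Finset.sum_congr rfl hterm, ← Finset.mul_sum]
    ring
  rw [hsplit]
  have h1 := hR x⁻¹ (by rwa [abs_of_pos (inv_pos.mpr hx0)])
  have hxd : 0 < x ^ (d K) := pow_pos hx0 _
  have h2 : 0 < c K * (c K + ∑ i ∈ Finset.range K, c i * x⁻¹ ^ (d K - d i)) := by
    have hc2 : 0 < |c K| := abs_pos.mpr hcK
    nlinarith [abs_le.mp h1.le, neg_abs_le (c K), le_abs_self (c K), mul_pos hc2 hc2, abs_mul_abs_self (c K)]
  have : c K * (x ^ d K * (c K + ∑ i ∈ Finset.range K, c i * x⁻¹ ^ (d K - d i)))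
      = x ^ d K * (c K * (c K + ∑ i ∈ Finset.range K, c i * x⁻¹ ^ (d K - d i))) := by ring
  rw [this]
  exact mul_pos hxd h2

/-! ### Sharpness gives simple zeros -/

/-- **Simple zeros**: if `Σ_{i ≤ K} c_i X^{d_i}` (all `c_i ≠ 0`) has at least `K` distinct positive zeros, then `f′ ≠ 0` at every
positive zero. [folklore] -/
theorem derivative_ne_zero_of_sharp (K : ℕ) (d : ℕ → ℕ) (hd : StrictMono d) (c : ℕ → ℝ) (hc : ∀ i, i < K + 1 → c i ≠ 0)
    (hroots : K ≤ ((∑ i ∈ Finset.range (K + 1), C (c i) * X ^ (d i) : ℝ[X]).roots.toFinset.filter (fun t => 0 < t)).card)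
    {z : ℝ} (hz0 : 0 < z) (hz : (∑ i ∈ Finset.range (K + 1), C (c i) * X ^ (d i) : ℝ[X]).eval z = 0) :
    (derivative (∑ i ∈ Finset.range (K + 1), C (c i) * X ^ (d i) : ℝ[X])).eval z ≠ 0 := by
  classical
  set f : ℝ[X] := ∑ i ∈ Finset.range (K + 1), C (c i) * X ^ (d i) with hf
  have hf0 : f ≠ 0 := (sparse_leadingCoeff K d hd c (hc K (by omega))).2
  intro hdz
  -- multiplicity of z is ≥ 2
  have hmult : 1 < f.rootMultiplicity z := by
    rw [Polynomial.one_lt_rootMultiplicity_iff_isRoot hf0]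
    exact ⟨hz, hdz⟩
  -- countP (0 < ·) roots ≥ card (distinct positive roots) + 1
  have hV : f.roots.countP (fun t => 0 < t) ≤ K :=
    (roots_countP_pos_le_signVariations f).trans (signVariations_sparse_le K d hd c hc)
  have hcount : ((f.roots.toFinset.filter (fun t => 0 < t)).card + 1 ≤ f.roots.countP (fun t => 0 < t)) := by
    rw [Multiset.countP_eq_card_filter, ← Multiset.toFinset_sum_count_eq]
    have hzmem : z ∈ (f.roots.filter (fun t => 0 < t)).toFinset := by
      rw [Multiset.mem_toFinset, Multiset.mem_filter, mem_roots hf0]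
      exact ⟨hz, hz0⟩
    have hset : (f.roots.filter (fun t => 0 < t)).toFinset = f.roots.toFinset.filter (fun t => 0 < t) := by
      ext t; simp
    rw [← hset, ← Finset.add_sum_erase _ _ hzmem]
    have h1 : 2 ≤ Multiset.count z (f.roots.filter (fun t => 0 < t)) := by
      rw [Multiset.count_filter_of_pos hz0, count_roots]
      exact hmult
    have h2 : ((f.roots.filter (fun t => 0 < t)).toFinset.erase z).card
        ≤ ∑ x ∈ (f.roots.filter (fun t => 0 < t)).toFinset.erase z, Multiset.count x (f.roots.filter (fun t => 0 < t)) := by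
      rw [Finset.card_eq_sum_ones]
      refine Finset.sum_le_sum (fun x hx => ?_)
      rw [Nat.one_le_iff_ne_zero, Multiset.count_ne_zero, ← Multiset.mem_toFinset]
      exact Finset.mem_of_mem_erase hx
    have h3 := Finset.card_erase_of_mem hzmem
    have h4 : 1 ≤ (f.roots.filter (fun t => 0 < t)).toFinset.card := Finset.card_pos.mpr ⟨z, hzmem⟩
    omega
  omega

end ProductPlusOne

end Summit.ValiantsHypothesis.ValiantsHypothesis.Theorems.LacunarySymmetroidMatrixDescartes
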